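import Mathlib
import Literature.NumberTheory.Irrationality.BrownZudilin2022.GeneralFamily
import Summits.KontsevichZagierPeriods.Zeta5Search.HypergeometricSaalschutz

/-!
# CF-Q (1/5): factorial toolkit, the `b`-coordinate double sum, and Step 1 (termwise factorisation)

HONEST FRAMING: systematic search; no irrationality claim unless certified.

Cell `pub-zeta5`, TYPER g6.  Part of the Lean proof of **CF-Q** (`WedgeDictionary.QWedgeClosedForm`, the closed form of
Brown–Zudilin's leading coefficient `Q(a)` (arXiv:2210.03391, (17)) on the eight-parameter wedge as a factorial ratio
times a terminating very-well-poised `₉F₈(1)`), found and proved on paper by planner gen-1 g4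
(`pub-zeta5-gen-1/PROOF-NOTES-g4.md` §9: trinomial revision → Burchnall–Chaundy/Dougall → Pfaff–Saalschütz ×4 → a
Pochhammer identity), formalised here.  Files: `QWedgeCFQBasic` (toolkit, the `b`-coordinate double sum, Step 1),
`QWedgeCFQKernel` (Steps 2–3), `QWedgeCFQAssembly` (Step 4, the identity for `n ≥ 2S+2`), `QWedgeCFQInterpolation`
(polynomial interpolation in `n` down to the pair conditions), `QWedgeClosedFormProof` (the dictionary `a ↔ (n,b)` and
`QWedgeClosedForm_holds`).

This file: rising factorials at integers as factorial ratios (`ph_neg_nat`, `ph_nat_succ`), integer binomials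
`zchoose` as factorial ratios (`zchoose_cast`), the (17)-summand in `b`-coordinates `termZ` / `LsumZ`
(`u = b₃ − i`, `v = b₇ − j`), the hypergeometric normalisation `t₁, t₂, E` and **Step 1**:
`termZ u v = E · t₁(u) t₂(v) · (a)_{u+v} / ((a)_u (a)_v (c)_{u+v})` for `n ≥ 2S+2` (`termZ_eq`).
-/

open Finset Polynomial

namespace Summit.KontsevichZagierPeriods.Zeta5Search.CFQ

open Summit.KontsevichZagierPeriods.Zeta5Search.Hypergeometric
open Literature.NumberTheory.Irrationality.BrownZudilin2022 (zchoose)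

/-! ### Rising factorials at integers as factorial ratios -/

/-- `(x)_{u+r} = (x)_u (x+u)_r`. -/
theorem ph_add (x : ℚ) (u r : ℕ) : ph x (u + r) = ph x u * ph (x + u) r := by
  unfold ph
  have h := congrArg (fun p => Polynomial.eval x p) (ascPochhammer_mul ℚ u r)
  simp only [eval_mul, eval_comp, eval_add, eval_X, eval_natCast] at h
  rw [← h]

/-- `(-b)_u = (-1)^u b!/(b-u)!` for `u ≤ b`. -/
theorem ph_neg_nat {b u : ℕ} (h : u ≤ b) :
    ph (-(b : ℚ)) u = (-1) ^ u * (b.factorial : ℚ) / ((b - u).factorial : ℚ) := by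
  unfold ph
  rw [ascPochhammer_eval_neg_eq_descPochhammer, descPochhammer_eval_eq_descFactorial]
  have hf : ((b - u).factorial : ℚ) ≠ 0 := by positivity
  rw [eq_div_iff hf, mul_assoc, ← Nat.cast_mul, mul_comm (b.descFactorial u),
    Nat.factorial_mul_descFactorial h]

/-- `(-b)_u = 0` for `b < u`. -/
theorem ph_neg_nat_of_lt {b u : ℕ} (h : b < u) : ph (-(b : ℚ)) u = 0 := by
  unfold ph; exact ascPochhammer_eval_neg_coe_nat_of_lt h

/-- `(x+1)_u = (x+u)!/x!` for a natural number `x`. -/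
theorem ph_nat_succ (x u : ℕ) : ph ((x : ℚ) + 1) u = ((x + u).factorial : ℚ) / (x.factorial : ℚ) := by
  unfold ph
  have hf : (x.factorial : ℚ) ≠ 0 := by positivity
  rw [eq_div_iff hf, show (x : ℚ) + 1 = ((x + 1 : ℕ) : ℚ) by push_cast; ring,
    ascPochhammer_nat_eq_natCast_ascFactorial, mul_comm, ← Nat.cast_mul, Nat.factorial_mul_ascFactorial]

/-- `(-b)_u ≠ 0` for `u ≤ b`. -/
theorem ph_neg_nat_ne_zero {b u : ℕ} (h : u ≤ b) : ph (-(b : ℚ)) u ≠ 0 := by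
  rw [ph_neg_nat h]
  have : ((b - u).factorial : ℚ) ≠ 0 := by positivity
  have : (b.factorial : ℚ) ≠ 0 := by positivity
  exact div_ne_zero (mul_ne_zero (pow_ne_zero _ (by norm_num)) ‹_›) ‹_›

/-- `(x+1)_u ≠ 0` for a natural number `x`. -/
theorem ph_nat_succ_ne_zero (x u : ℕ) : ph ((x : ℚ) + 1) u ≠ 0 := by
  rw [ph_nat_succ]; positivity

/-! ### Integer binomials `zchoose` as factorial ratios -/

/-- `zchoose N K = N!/(K!(N-K)!)` when the integers `N ≥ K ≥ 0` are the casts of naturals `nN ≥ nK`. -/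
theorem zchoose_cast {N K : ℤ} {nN nK : ℕ} (hN : N = nN) (hK : K = nK) (h : nK ≤ nN) :
    ((zchoose N K : ℤ) : ℚ) = (nN.factorial : ℚ) / ((nK.factorial : ℚ) * ((nN - nK).factorial : ℚ)) := by
  subst hN; subst hK
  unfold zchoose
  rw [if_pos ⟨by omega, by exact_mod_cast h⟩, Int.toNat_natCast, Int.toNat_natCast]
  push_cast
  exact Nat.cast_choose ℚ h

/-- `zchoose N K = 0` when `K < 0`. -/
theorem zchoose_neg {N K : ℤ} (h : K < 0) : zchoose N K = 0 := by
  unfold zchoose; rw [if_neg]; omega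

/-- `zchoose N K = 0` when `N < K`. -/
theorem zchoose_lt {N K : ℤ} (h : N < K) : zchoose N K = 0 := by
  unfold zchoose; rw [if_neg]; omega

/-! ### The double sum (17) in `b`-coordinates

With `n = b₀` and `u = b₃ − i`, `v = b₇ − j` (so that all supports start at `0`), the summand of
Brown–Zudilin's (17) at `a = a(n;b)` is, up to the global sign `(−1)^{n+S}`,
`C(n−u−b₆, b₄−u) C(n−v−b₆, b₁−v) C(n−u−v, b₆) C(b₃, u) C(n−b₃−b₄, b₅−u) C(n−b₁−b₂, b₇−v) C(b₂, v)`
(integer binomials, `0` off range). -/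

/-- The (17)-summand in `b`-coordinates (reflected indices `u = b₃ − i`, `v = b₇ − j`). -/
def termZ (n : ℕ) (b : ℕ → ℕ) (u v : ℕ) : ℤ :=
  zchoose ((n : ℤ) - u - b 6) ((b 4 : ℤ) - u) * zchoose ((n : ℤ) - v - b 6) ((b 1 : ℤ) - v) *
    zchoose ((n : ℤ) - u - v) (b 6) * zchoose (b 3) u * zchoose ((n : ℤ) - b 3 - b 4) ((b 5 : ℤ) - u) *
    zchoose ((n : ℤ) - b 1 - b 2) ((b 7 : ℤ) - v) * zchoose (b 2) v

/-- The (17) double sum in `b`-coordinates: `L(b;n) = Σ_{u ≤ b₃} Σ_{v ≤ b₇} termZ`. -/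
def LsumZ (n : ℕ) (b : ℕ → ℕ) : ℤ :=
  ∑ u ∈ range (b 3 + 1), ∑ v ∈ range (b 7 + 1), termZ n b u v

/-- `S = b₁ + ⋯ + b₇`. -/
def S7 (b : ℕ → ℕ) : ℕ := b 1 + b 2 + b 3 + b 4 + b 5 + b 6 + b 7

/-! ### The hypergeometric normalisation (Step 1 of PROOF-NOTES-g4 §9)

`a = b₆ − n`, `c = −n`, `σ₁ = b₃+b₄+b₅`, `σ₂ = b₁+b₂+b₇`;
`t₁(u) = (−b₃)_u(−b₄)_u(−b₅)_u / (u! (n+1−σ₁)_u)`, `t₂(v)` likewise with `b₁,b₂,b₇, σ₂`;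
`E = E(n;b)` the `u,v`-free factorial constant below.  Then for `n ≥ 2S+2`:
`termZ u v = E · t₁(u) t₂(v) · (a)_{u+v} / ((a)_u (a)_v (c)_{u+v})`. -/

/-- `a = b₆ − n`. -/
def aPar (n : ℕ) (b : ℕ → ℕ) : ℚ := (b 6 : ℚ) - n
/-- `c = −n`. -/
def cPar (n : ℕ) : ℚ := -(n : ℚ)

/-- `t₁(u) = (−b₃)_u(−b₄)_u(−b₅)_u / (u! (n+1−σ₁)_u)`. -/
noncomputable def t1 (n : ℕ) (b : ℕ → ℕ) (u : ℕ) : ℚ :=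
  ph (-(b 3 : ℚ)) u * ph (-(b 4 : ℚ)) u * ph (-(b 5 : ℚ)) u /
    ((u.factorial : ℚ) * ph ((n : ℚ) + 1 - (b 3 + b 4 + b 5 : ℕ)) u)

/-- `t₂(v) = (−b₇)_v(−b₁)_v(−b₂)_v / (v! (n+1−σ₂)_v)`. -/
noncomputable def t2 (n : ℕ) (b : ℕ → ℕ) (v : ℕ) : ℚ :=
  ph (-(b 7 : ℚ)) v * ph (-(b 1 : ℚ)) v * ph (-(b 2 : ℚ)) v /
    ((v.factorial : ℚ) * ph ((n : ℚ) + 1 - (b 7 + b 1 + b 2 : ℕ)) v)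

/-- a factorial, cast to `ℚ` (local abbreviation) -/
def fq (m : ℕ) : ℚ := (m.factorial : ℚ)

/-- `fq m ≠ 0`. -/
theorem fq_ne_zero (m : ℕ) : fq m ≠ 0 := by unfold fq; positivity

/-- The constant `E(n;b) = C(n−b₄,K)C(n−b₁,K)/C(n,K) · C(n,b₄) C(n−b₃−b₄,b₅) C(n,b₁) C(n−b₁−b₂,b₇)`,
`K = b₆`, written out in factorials. -/
noncomputable def Econst (n : ℕ) (b : ℕ → ℕ) : ℚ :=
  (fq (n - b 4) / (fq (b 6) * fq (n - b 4 - b 6))) * (fq (n - b 1) / (fq (b 6) * fq (n - b 1 - b 6))) /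
      (fq n / (fq (b 6) * fq (n - b 6))) *
    (fq n / (fq (b 4) * fq (n - b 4))) * (fq (n - b 3 - b 4) / (fq (b 5) * fq (n - (b 3 + b 4 + b 5)))) *
    (fq n / (fq (b 1) * fq (n - b 1))) * (fq (n - b 1 - b 2) / (fq (b 7) * fq (n - (b 7 + b 1 + b 2))))

/-- `t₁(u) = 0` for `u > b₄` or `u > b₅` (or `u > b₃`). -/
theorem t1_eq_zero {n : ℕ} {b : ℕ → ℕ} {u : ℕ} (h : b 3 < u ∨ b 4 < u ∨ b 5 < u) : t1 n b u = 0 := by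
  unfold t1
  rcases h with h | h | h
  · rw [ph_neg_nat_of_lt h]; simp
  · rw [ph_neg_nat_of_lt (b := b 4) h]; simp
  · rw [ph_neg_nat_of_lt (b := b 5) h]; simp

/-- `t₂(v) = 0` for `v > b₇`, `v > b₁` or `v > b₂`. -/
theorem t2_eq_zero {n : ℕ} {b : ℕ → ℕ} {v : ℕ} (h : b 7 < v ∨ b 1 < v ∨ b 2 < v) : t2 n b v = 0 := by
  unfold t2
  rcases h with h | h | h
  · rw [ph_neg_nat_of_lt h]; simp
  · rw [ph_neg_nat_of_lt (b := b 1) h]; simp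
  · rw [ph_neg_nat_of_lt (b := b 2) h]; simp

/-- `((-1)^u)^2 = 1` in the form used to merge three sign factors. -/
theorem neg_one_pow_mul_self (u : ℕ) : ((-1 : ℚ) ^ u) * ((-1 : ℚ) ^ u) = 1 := by
  rw [← pow_add, ← two_mul, pow_mul]; norm_num

/-- `t₁(u)` in factorials (one sign factor), for `u ≤ b₃, b₄, b₅` and `σ₁ ≤ n`. -/
theorem t1_eq {n : ℕ} {b : ℕ → ℕ} {u : ℕ} (h3 : u ≤ b 3) (h4 : u ≤ b 4) (h5 : u ≤ b 5)
    (hn : b 3 + b 4 + b 5 ≤ n) :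
    t1 n b u = (-1) ^ u * (fq (b 3) * fq (b 4) * fq (b 5) * fq (n - (b 3 + b 4 + b 5))) /
      (fq (b 3 - u) * fq (b 4 - u) * fq (b 5 - u) * fq u * fq (n - (b 3 + b 4 + b 5) + u)) := by
  unfold t1
  rw [ph_neg_nat h3, ph_neg_nat h4, ph_neg_nat h5,
    show (n : ℚ) + 1 - ((b 3 + b 4 + b 5 : ℕ) : ℚ) = ((n - (b 3 + b 4 + b 5) : ℕ) : ℚ) + 1 by
      rw [Nat.cast_sub hn]; ring,
    ph_nat_succ]
  simp only [fq]
  have hA : ∀ A B C D E F G : ℚ, (-1) ^ u * A / B * ((-1) ^ u * C / D) * ((-1) ^ u * E / F) / G =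
      ((-1 : ℚ) ^ u * (-1) ^ u) * ((-1) ^ u * (A / B * (C / D) * (E / F) / G)) := fun _ _ _ _ _ _ _ => by ring
  rw [hA, neg_one_pow_mul_self, one_mul]
  have := fq_ne_zero (b 3 - u); have := fq_ne_zero (b 4 - u); have := fq_ne_zero (b 5 - u)
  have := fq_ne_zero u; have := fq_ne_zero (n - (b 3 + b 4 + b 5)); have := fq_ne_zero (n - (b 3 + b 4 + b 5) + u)
  unfold fq at *
  field_simp

/-- `t₂(v)` in factorials (one sign factor), for `v ≤ b₇, b₁, b₂` and `σ₂ ≤ n`. -/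
theorem t2_eq {n : ℕ} {b : ℕ → ℕ} {v : ℕ} (h7 : v ≤ b 7) (h1 : v ≤ b 1) (h2 : v ≤ b 2)
    (hn : b 7 + b 1 + b 2 ≤ n) :
    t2 n b v = (-1) ^ v * (fq (b 7) * fq (b 1) * fq (b 2) * fq (n - (b 7 + b 1 + b 2))) /
      (fq (b 7 - v) * fq (b 1 - v) * fq (b 2 - v) * fq v * fq (n - (b 7 + b 1 + b 2) + v)) := by
  unfold t2
  rw [ph_neg_nat h7, ph_neg_nat h1, ph_neg_nat h2,
    show (n : ℚ) + 1 - ((b 7 + b 1 + b 2 : ℕ) : ℚ) = ((n - (b 7 + b 1 + b 2) : ℕ) : ℚ) + 1 by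
      rw [Nat.cast_sub hn]; ring,
    ph_nat_succ]
  simp only [fq]
  have hA : ∀ A B C D E F G : ℚ, (-1) ^ v * A / B * ((-1) ^ v * C / D) * ((-1) ^ v * E / F) / G =
      ((-1 : ℚ) ^ v * (-1) ^ v) * ((-1) ^ v * (A / B * (C / D) * (E / F) / G)) := fun _ _ _ _ _ _ _ => by ring
  rw [hA, neg_one_pow_mul_self, one_mul]
  have := fq_ne_zero (b 7 - v); have := fq_ne_zero (b 1 - v); have := fq_ne_zero (b 2 - v)
  have := fq_ne_zero v; have := fq_ne_zero (n - (b 7 + b 1 + b 2)); have := fq_ne_zero (n - (b 7 + b 1 + b 2) + v)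
  unfold fq at *
  field_simp

/-- `(a)_k = (b₆ − n)_k` in factorials (`k + b₆ ≤ n`). -/
theorem ph_aPar_eq {n : ℕ} {b : ℕ → ℕ} {k : ℕ} (h : k + b 6 ≤ n) :
    ph (aPar n b) k = (-1) ^ k * fq (n - b 6) / fq (n - b 6 - k) := by
  unfold aPar fq
  rw [show (b 6 : ℚ) - n = -((n - b 6 : ℕ) : ℚ) by rw [Nat.cast_sub (by omega)]; ring, ph_neg_nat (by omega)]

/-- `(c)_k = (−n)_k` in factorials (`k ≤ n`). -/
theorem ph_cPar_eq {n k : ℕ} (h : k ≤ n) : ph (cPar n) k = (-1) ^ k * fq n / fq (n - k) := by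
  unfold cPar fq; rw [ph_neg_nat h]

/-- `(a)_k ≠ 0` for `k + b₆ ≤ n`. -/
theorem ph_aPar_ne_zero {n : ℕ} {b : ℕ → ℕ} {k : ℕ} (h : k + b 6 ≤ n) : ph (aPar n b) k ≠ 0 := by
  rw [ph_aPar_eq h]
  exact div_ne_zero (mul_ne_zero (pow_ne_zero _ (by norm_num)) (fq_ne_zero _)) (fq_ne_zero _)

/-- `(c)_k ≠ 0` for `k ≤ n`. -/
theorem ph_cPar_ne_zero {n k : ℕ} (h : k ≤ n) : ph (cPar n) k ≠ 0 := by
  rw [ph_cPar_eq h]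
  exact div_ne_zero (mul_ne_zero (pow_ne_zero _ (by norm_num)) (fq_ne_zero _)) (fq_ne_zero _)

/-- **Step 1, termwise.**  For `u ≤ b₃`, `v ≤ b₇` and `n ≥ 2S + 2`:
`termZ u v = E · t₁(u) t₂(v) · (a)_{u+v} / ((a)_u (a)_v (c)_{u+v})`. -/
theorem termZ_eq {n : ℕ} {b : ℕ → ℕ} {u v : ℕ} (hu : u ≤ b 3) (hv : v ≤ b 7) (hN : 2 * S7 b + 2 ≤ n) :
    (termZ n b u v : ℚ) = Econst n b * t1 n b u * t2 n b v * ph (aPar n b) (u + v) /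
      (ph (aPar n b) u * ph (aPar n b) v * ph (cPar n) (u + v)) := by
  unfold S7 at hN
  by_cases h4 : u ≤ b 4
  swap
  · -- `u > b₄`: both sides vanish
    push Not at h4
    have hz : zchoose ((n : ℤ) - u - b 6) ((b 4 : ℤ) - u) = 0 := zchoose_neg (by omega)
    rw [t1_eq_zero (Or.inr (Or.inl h4))]
    simp [termZ, hz]
  by_cases h5 : u ≤ b 5
  swap
  · push Not at h5
    have hz : zchoose ((n : ℤ) - b 3 - b 4) ((b 5 : ℤ) - u) = 0 := zchoose_neg (by omega)
    rw [t1_eq_zero (Or.inr (Or.inr h5))]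
    simp [termZ, hz]
  by_cases h1 : v ≤ b 1
  swap
  · push Not at h1
    have hz : zchoose ((n : ℤ) - v - b 6) ((b 1 : ℤ) - v) = 0 := zchoose_neg (by omega)
    rw [t2_eq_zero (Or.inr (Or.inl h1))]
    simp [termZ, hz]
  by_cases h2 : v ≤ b 2
  swap
  · push Not at h2
    have hz : zchoose (b 2 : ℤ) (v : ℤ) = 0 := zchoose_lt (by exact_mod_cast h2)
    rw [t2_eq_zero (Or.inr (Or.inr h2))]
    simp [termZ, hz]
  -- main case: everything in range
  have c1 : ((n : ℤ) - u - b 6) = ((n - u - b 6 : ℕ) : ℤ) := by omega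
  have c1' : ((b 4 : ℤ) - u) = ((b 4 - u : ℕ) : ℤ) := by omega
  have c2 : ((n : ℤ) - v - b 6) = ((n - v - b 6 : ℕ) : ℤ) := by omega
  have c2' : ((b 1 : ℤ) - v) = ((b 1 - v : ℕ) : ℤ) := by omega
  have c3 : ((n : ℤ) - u - v) = ((n - u - v : ℕ) : ℤ) := by omega
  have c5 : ((n : ℤ) - b 3 - b 4) = ((n - b 3 - b 4 : ℕ) : ℤ) := by omega
  have c5' : ((b 5 : ℤ) - u) = ((b 5 - u : ℕ) : ℤ) := by omega
  have c6 : ((n : ℤ) - b 1 - b 2) = ((n - b 1 - b 2 : ℕ) : ℤ) := by omega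
  have c6' : ((b 7 : ℤ) - v) = ((b 7 - v : ℕ) : ℤ) := by omega
  unfold termZ
  push_cast
  rw [zchoose_cast c1 c1' (by omega), zchoose_cast c2 c2' (by omega), zchoose_cast c3 rfl (by omega),
    zchoose_cast (nN := b 3) (nK := u) rfl rfl hu, zchoose_cast c5 c5' (by omega),
    zchoose_cast c6 c6' (by omega), zchoose_cast (nN := b 2) (nK := v) rfl rfl h2,
    t1_eq hu h4 h5 (by omega), t2_eq hv h1 h2 (by omega),
    ph_aPar_eq (k := u + v) (by omega), ph_aPar_eq (k := u) (by omega), ph_aPar_eq (k := v) (by omega),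
    ph_cPar_eq (k := u + v) (by omega)]
  unfold Econst
  simp only [pow_add]
  -- align the factorial arguments
  have e1 : n - u - b 6 - (b 4 - u) = n - b 4 - b 6 := by omega
  have e2 : n - v - b 6 - (b 1 - v) = n - b 1 - b 6 := by omega
  have e3 : n - b 3 - b 4 - (b 5 - u) = n - (b 3 + b 4 + b 5) + u := by omega
  have e4 : n - b 1 - b 2 - (b 7 - v) = n - (b 7 + b 1 + b 2) + v := by omega
  have e5 : n - b 6 - (u + v) = n - u - v - b 6 := by omega
  have e6 : n - u - b 6 = n - b 6 - u := by omega
  have e7 : n - v - b 6 = n - b 6 - v := by omega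
  have e8 : n - (u + v) = n - u - v := by omega
  rw [e1, e2, e3, e4, e5, e6, e7, e8]
  simp only [fq]
  field_simp


end Summit.KontsevichZagierPeriods.Zeta5Search.CFQ
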